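import Literature.Geometry.Symplectic.JHolomorphicMap
import Literature.Geometry.Symplectic.JHolomorphicReparametrisation
import Mathlib.Geometry.Manifold.ContMDiff.NormedSpace
import Mathlib.Geometry.Manifold.Instances.Real
import Mathlib.Analysis.Calculus.InverseFunctionTheorem.FDeriv
import Mathlib.Topology.UniformSpace.UniformConvergence
import Mathlib.Analysis.Complex.Basic
import Mathlib.LinearAlgebra.FiniteDimensional.Lemmas

/-!
# Glue for the local reduction of McDuff's limit theorem — auxiliary lemmas

Crux `WitnessCharge` (stmt-SmoothPoincare4-7824), line `Sketch`, continuation lead c5 (cycle 5).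
Elementary lemmas about smooth maps `ℂ → V` into a `4`-manifold used by the reduction
`jHolomorphicLimitOfEmbedded_isEmbedded_of_local` (`…LimitEmbeddedLocal.lean`) of the named fact
`Literature.Geometry.Symplectic.jHolomorphicLimitOfEmbedded_isEmbedded` (McDuff 1991 §4, input
L1b of the line) to the five LOCAL named facts of
`Literature/Geometry/Symplectic/JHolomorphicLocalIntersections.lean`:

* shifts `z ↦ f (z + c)`: smoothness, `J`-holomorphicity (`IsJHolomorphic.comp_affine`),
  the differential `d(f(· + c))(z₀) = df(z₀ + c)`, and transfer of locally uniform convergence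
  through an embedding `ι` to closed discs;
* `exists_injOn_ball_of_mfderiv_injective` (registered helper): a `C^∞` map `ℂ → V` with
  injective differential at `t` is injective on a disc around `t` (inverse function theorem for
  `P ∘ ι ∘ G` with `P` a linear left inverse of the injective derivative of `ι ∘ G`);
* two metric trivialities (`ball c (r − ‖c‖) ⊆ ball 0 r`, the norm of the real point
  `(r₀ + r₁)/2`).
-/

noncomputable section

set_option linter.dupNamespace false

open scoped Manifold ContDiff Topology
open Set Filter

namespace Summit.SmoothPoincare4.SmoothPoincare4.Theorems.WitnessCharge.PencilIncompleteness

open Literature.Geometry.Symplectic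

section Shifts

variable {V : Type} [TopologicalSpace V] [ChartedSpace (EuclideanSpace ℝ (Fin 4)) V]

/-! ### Shifts `z ↦ f (z + c)` of smooth / `J`-holomorphic maps `ℂ → V` -/

/-- Translation `z ↦ z + c` of `ℂ` is `C^∞`. -/
theorem contMDiff_add_const (c : ℂ) : ContMDiff 𝓘(ℝ, ℂ) 𝓘(ℝ, ℂ) ∞ (fun z : ℂ => z + c) :=
  contMDiff_iff_contDiff.2 (contDiff_id.add contDiff_const)

/-- A shift of a `C^∞` map `ℂ → V` is `C^∞`. -/
theorem contMDiff_comp_add_const {f : ℂ → V} (hf : ContMDiff 𝓘(ℝ, ℂ) (𝓡 4) ∞ f) (c : ℂ) :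
    ContMDiff 𝓘(ℝ, ℂ) (𝓡 4) ∞ (fun z : ℂ => f (z + c)) :=
  hf.comp (contMDiff_add_const c)

/-- A shift of a smooth `J`-holomorphic map is `J`-holomorphic. -/
theorem isJHolomorphic_comp_add_const {J : ∀ x : V, TangentSpace (𝓡 4) x →L[ℝ] TangentSpace (𝓡 4) x}
    {f : ℂ → V} (hf : ContMDiff 𝓘(ℝ, ℂ) (𝓡 4) ∞ f) (hJ : IsJHolomorphic (𝓡 4) J f) (c : ℂ) :
    IsJHolomorphic (𝓡 4) J (fun z : ℂ => f (z + c)) := by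
  have h := hJ.comp_affine (fun z => (hf z).mdifferentiableAt (by simp)) 1 c
  have e : (f ∘ fun z => (1 : ℂ) * z + c) = fun z => f (z + c) :=
    funext fun z => by simp only [Function.comp_apply, one_mul]
  rwa [e] at h

/-- The differential of a shift: `d(f(· + c))(z₀) = df(z₀ + c)`. -/
theorem mfderiv_comp_add_const {f : ℂ → V} (hf : ContMDiff 𝓘(ℝ, ℂ) (𝓡 4) ∞ f) (c z₀ : ℂ) :
    mfderiv 𝓘(ℝ, ℂ) (𝓡 4) (fun z : ℂ => f (z + c)) z₀ = mfderiv 𝓘(ℝ, ℂ) (𝓡 4) f (z₀ + c) := by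
  have htr : HasMFDerivAt 𝓘(ℝ, ℂ) 𝓘(ℝ, ℂ) (fun z : ℂ => z + c) z₀
      (ContinuousLinearMap.id ℝ ℂ) :=
    ((hasFDerivAt_id z₀).add_const c).hasMFDerivAt
  have hf' : HasMFDerivAt 𝓘(ℝ, ℂ) (𝓡 4) f (z₀ + c) (mfderiv 𝓘(ℝ, ℂ) (𝓡 4) f (z₀ + c)) :=
    ((hf (z₀ + c)).mdifferentiableAt (by simp)).hasMFDerivAt
  have hcomp : HasMFDerivAt 𝓘(ℝ, ℂ) (𝓡 4) (fun z : ℂ => f (z + c)) z₀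
      ((mfderiv 𝓘(ℝ, ℂ) (𝓡 4) f (z₀ + c)).comp (ContinuousLinearMap.id ℝ ℂ)) :=
    hf'.comp z₀ htr
  exact hcomp.mfderiv.trans (ContinuousLinearMap.comp_id _)

/-- Locally uniform convergence through `ι` transfers to shifts, on closed discs. -/
theorem tendstoUniformlyOn_comp_add_const {W X : Type*} [PseudoMetricSpace X] {ι : W → X}
    {u : ℕ → ℂ → W} {G : ℂ → W}
    (h : ∀ D : Set ℂ, IsCompact D →
      TendstoUniformlyOn (fun n ζ => ι (u n ζ)) (fun ζ => ι (G ζ)) atTop D)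
    (c : ℂ) (ρ : ℝ) :
    TendstoUniformlyOn (fun n z => ι (u n (z + c))) (fun z => ι (G (z + c))) atTop
      (Metric.closedBall (0 : ℂ) ρ) := by
  have h1 := (h (Metric.closedBall c ρ) (isCompact_closedBall c ρ)).comp (fun z : ℂ => z + c)
  refine h1.mono ?_
  intro z hz
  simp only [Set.mem_preimage, Metric.mem_closedBall, dist_eq_norm, add_sub_cancel_right]
  simpa [Metric.mem_closedBall, dist_eq_norm] using hz

end Shifts

/-! ### An immersed point is a locally injective point -/

/-- **A `C^∞` map `ℂ → V` with injective differential at `t` is injective near `t`** (read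
through a smooth immersion `ι : V → ℝᴺ` with injective differentials: `ι ∘ G` has injective
derivative at `t`; compose with a linear left inverse and apply the inverse function theorem).
Registered helper of crux stmt-SmoothPoincare4-7824. -/
theorem exists_injOn_ball_of_mfderiv_injective :
    ∀ {V : Type} [TopologicalSpace V] [ChartedSpace (EuclideanSpace ℝ (Fin 4)) V]
      {N : ℕ} {ι : V → EuclideanSpace ℝ (Fin N)},
      ContMDiff (𝓡 4) 𝓘(ℝ, EuclideanSpace ℝ (Fin N)) ∞ ι →
      (∀ x : V, Function.Injective (mfderiv (𝓡 4) 𝓘(ℝ, EuclideanSpace ℝ (Fin N)) ι x)) →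
      ∀ {G : ℂ → V}, ContMDiff 𝓘(ℝ, ℂ) (𝓡 4) ∞ G → ∀ {t : ℂ},
        Function.Injective (mfderiv 𝓘(ℝ, ℂ) (𝓡 4) G t) →
        ∃ ρ : ℝ, 0 < ρ ∧ Set.InjOn G (Metric.ball t ρ) := by
  intro V _ _ N ι hιs hιd G hG t ht
  set F : ℂ → EuclideanSpace ℝ (Fin N) := fun z => ι (G z) with hF
  have hFs : ContMDiff 𝓘(ℝ, ℂ) 𝓘(ℝ, EuclideanSpace ℝ (Fin N)) ∞ F := hιs.comp hG
  have hFd : ContDiff ℝ ∞ F := contMDiff_iff_contDiff.1 hFs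
  -- the derivative of `F` at `t` is injective
  have hmf : mfderiv 𝓘(ℝ, ℂ) 𝓘(ℝ, EuclideanSpace ℝ (Fin N)) F t =
      (mfderiv (𝓡 4) 𝓘(ℝ, EuclideanSpace ℝ (Fin N)) ι (G t)).comp (mfderiv 𝓘(ℝ, ℂ) (𝓡 4) G t) :=
    mfderiv_comp t ((hιs (G t)).mdifferentiableAt (by simp)) ((hG t).mdifferentiableAt (by simp))
  have hLinj : Function.Injective (fderiv ℝ F t) := by
    rw [← mfderiv_eq_fderiv, hmf]
    exact (hιd (G t)).comp ht
  -- a continuous linear left inverse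
  set L : ℂ →L[ℝ] EuclideanSpace ℝ (Fin N) := fderiv ℝ F t with hL
  obtain ⟨P, hP⟩ := (L : ℂ →ₗ[ℝ] EuclideanSpace ℝ (Fin N)).exists_leftInverse_of_injective
    (LinearMap.ker_eq_bot.2 hLinj)
  set Pc : EuclideanSpace ℝ (Fin N) →L[ℝ] ℂ := LinearMap.toContinuousLinearMap P with hPc
  have hPL : ∀ v : ℂ, Pc (L v) = v := fun v => by
    have := LinearMap.congr_fun hP v
    change P (L v) = v
    simpa using this
  -- `H := Pc ∘ F` has derivative the identity at `t`
  set H : ℂ → ℂ := fun z => Pc (F z) with hH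
  have hHd : HasStrictFDerivAt H ((ContinuousLinearEquiv.refl ℝ ℂ : ℂ ≃L[ℝ] ℂ) : ℂ →L[ℝ] ℂ) t := by
    have h1 : HasStrictFDerivAt F L t := (hFd.contDiffAt.hasStrictFDerivAt (by simp))
    have h2 : HasStrictFDerivAt H (Pc.comp L) t := Pc.hasStrictFDerivAt.comp t h1
    have e : Pc.comp L = ((ContinuousLinearEquiv.refl ℝ ℂ : ℂ ≃L[ℝ] ℂ) : ℂ →L[ℝ] ℂ) := by
      ext1 v
      simp [hPL]
    rwa [e] at h2
  -- inverse function theorem: `H` is injective on a neighbourhood of `t`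
  set Φ := hHd.toOpenPartialHomeomorph H with hΦ
  have hsrc : Φ.source ∈ 𝓝 t :=
    Φ.open_source.mem_nhds hHd.mem_toOpenPartialHomeomorph_source
  have hcoe : (Φ : ℂ → ℂ) = H := hHd.toOpenPartialHomeomorph_coe
  obtain ⟨ρ, hρ, hball⟩ := Metric.mem_nhds_iff.1 hsrc
  refine ⟨ρ, hρ, fun x hx y hy hxy => ?_⟩
  have hHxy : H x = H y := by simp only [hH, hF, hxy]
  have hΦxy : Φ x = Φ y := by rw [hcoe]; exact hHxy
  exact Φ.injOn (hball hx) (hball hy) hΦxy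


/-! ### Two metric trivialities -/

/-- `ball c (r - ‖c‖) ⊆ ball 0 r`. -/
theorem ball_sub_norm_subset_ball (c : ℂ) (r : ℝ) :
    Metric.ball c (r - ‖c‖) ⊆ Metric.ball (0 : ℂ) r := by
  intro x hx
  rw [Metric.mem_ball, dist_eq_norm] at hx
  rw [mem_ball_zero_iff]
  calc ‖x‖ = ‖(x - c) + c‖ := by rw [sub_add_cancel]
    _ ≤ ‖x - c‖ + ‖c‖ := norm_add_le _ _
    _ < (r - ‖c‖) + ‖c‖ := by linarith
    _ = r := by ring

/-- The real point `(r₀ + r₁)/2` of `ℂ` has norm `(r₀ + r₁)/2` when `0 < r₀ < r₁`. -/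
theorem norm_midpoint_cast {r₀ r₁ : ℝ} (hr₀ : 0 < r₀) (hr₁ : r₀ < r₁) :
    ‖(((r₀ + r₁) / 2 : ℝ) : ℂ)‖ = (r₀ + r₁) / 2 := by
  rw [Complex.norm_real, Real.norm_eq_abs, abs_of_pos (by linarith)]

end Summit.SmoothPoincare4.SmoothPoincare4.Theorems.WitnessCharge.PencilIncompleteness
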